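import Summits.QuantumFields.YangMills.Theorems.BalabanUVNodesN15PerCubeGreenCovariantClose
import Summits.QuantumFields.YangMills.Theorems.BalabanUVNodesN15PerCubeGreenJetGreen
import Summits.QuantumFields.YangMills.Theorems.BalabanUVNodesN15PerCubeGreenJetCovDClose
import HarnessLib

/-!
# N15 = NE2, road (c) — PROGRAMME (PC), (PC-D) «the per-cube LANDAU LETTER», ENTRY 2: ★★★★ THE COVARIANT GRADIENT OF THE NAMED GREEN's FUNCTION AGAINST THE FLAT ONE —
# `D_{U,μ}G′(U) − ∂_μG′(𝟙) = pull_μ∘mulVecLin (cgrad (cvT e U)·cGreen (cvT e U) a) − pull_μ∘mulVecLin (cgrad 𝟙·cGreen 𝟙 a) ≤ B·[κ·(Σ(r_V) + (L^m)⁻¹ + e^{−(3δ∕128)d_Z(y)}) + r_Ve^{δ}]·e^{−(δ∕64)d}`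
# for a `U(m)` field (3.35)-small in the TRIVIAL gauge on the two-collar boxes of the cubes NOT `Far` and in Bałaban's class on the far ones (dag-n15-c g29, n15-c∕305)

Cell `pub-ymgap`, seat `pub-ymgap-dag-n15-c` (generation g29; R134 (a), s1; HUMAN RULING D-0062).  `bears_on: R4∕N15 · K3⁸ SpineGivenEndpointR13SepCoPHV (stmt-QuantumFields-27366)`;
filed `--kind proof --supports stmt-QuantumFields-27366 --as helper` — COUNT-NEUTRAL.  One theorem, 0 `sorry`, 0 `def`.  GENERATED from the TREE text of n15-c∕296
`…PerCubeGreenCovariantClose` (its gauge bookkeeping for the two knits VERBATIM, the (3.35) data moved to the two-collar boxes of n15-c∕275 so that the transport letter one step before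
the cut box is available) over n15-c∕304 `uN_covD_scGlued_sub_spec`, closed by n15-c∕262's inverse identities + n15-c∕266's dictionary (`eq_mulVecLin_cGreen_of_comp_eq_id`) +
n15-c∕270's `covD_comp_mulVecLin_eq_pull` + `cvT_one` exactly as n15-c∕276.  Imports 296, 276, 304 BY NAME.  Nothing in the tree is modified.

WHY ((PC-D), HOME `PCD-DESIGN-g28.md`).  The per-cube Landau letter `M_χ(landauCov(V) − landauCov(𝟙))M_χ` is a triple-product telescoping (n15-c∕299j) whose factors need CLOSENESS rows
with the far weight `e^{−cd_Z(y)}`: `G′` (296 ✓), `S = Q′G′²Q′ᵀ` (299a ✓), `S⁻¹` (299i ✓) and the gradient entries.  THIS FILE is entry 2: `D_VG′(V) − ∂G′(𝟙)` for `V` (3.35)-small in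
the trivial gauge near the cube (the cube's own gauge `u_□` makes `V = U^{u_□}` so on its walk-locality box) — no derivative of a difference is ever taken (n15-c∕300–304).

HONEST FRAMING ∕ LIMITS.  MODEL carriers (the cover of n15-c∕260 on the doubled unit torus); composition of LANDED theorems; [B9] (3.34)–(3.35) p.396, (3.42) p.397, Cor. 3.8 p.410,
(3.95)–(3.96) p.411, Thm 3.14 pp.426–427 cited for SHAPES ∕ MECHANISM, NOT the printed statements.  NE2⁺ NOT PRINTED, NOT proved; N15 of record untouched (DISCHARGED AS CONSUMED,
p687738); K3⁸ OPEN; counts of record UNMOVED; one finite 𝕋⁴ at fixed ε per index — NOT infinite volume, NOT OS on ℝ⁴, NOT a mass gap, NOT Clay.  Restate-immune (no Theses import).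
-/

noncomputable section

open scoped BigOperators Matrix Matrix.Norms.L2Operator

namespace Summit.QuantumFields.YangMills.BalabanUVNodes.N15.Gluing

open Real
open Literature.MathematicalPhysics.QuantumFieldTheory.Balaban1983to89
open Literature.MathematicalPhysics.QuantumFieldTheory.Balaban1983to89.B5Prop11Plancherel (Tor fine unitVec)
open Literature.MathematicalPhysics.QuantumFieldTheory.Balaban1983to89.B11SectG (BlockNorm HasMaj hasMaj_zero)
open Literature.MathematicalPhysics.QuantumFieldTheory.Balaban1983to89.B6Prop26Gluing (mulOp)
open Literature.MathematicalPhysics.QuantumFieldTheory.Balaban1983to89.B6UnitTorusCarrier (unitTorusGeo)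
open Literature.MathematicalPhysics.QuantumFieldTheory.Balaban1983to89.B9Eq335RegularityClasses (Reg335Cube)
open Literature.MathematicalPhysics.QuantumFieldTheory.Balaban1983to89.B9Eq3117Current (gaugeTr gaugeTr_apply)
open Literature.MathematicalPhysics.QuantumFieldTheory.Balaban1983to89.B9Eq39Adjoint (covD fluct)
open Literature.MathematicalPhysics.QuantumFieldTheory.Balaban1983to89.B9BackgroundsKLevelV1 (fluct_zero)
open Summit.QuantumFields.YangMills.BalabanUVNodes.N15.CovLandau (claplA cGreen)
open Literature.MathematicalPhysics.QuantumFieldTheory.King1986 (aK aK_pos aK_le)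
open Literature.MathematicalPhysics.QuantumFieldTheory.King1986.Torus (blockOf)
open Literature.Barriers.QuantumFields (traceForm)
open Summit.QuantumFields.YangMills.BalabanUVNodes.N15.BackgroundLayer (covLapM tCoefA tCoefC)
open Summit.QuantumFields.YangMills.BalabanUVNodes.N15.VectorPiece (bshiftEquiv bshiftEquiv_apply)
open Summit.QuantumFields.YangMills.BalabanUVNodes.N15.MatrixSpecies (mmulOp coordMat basisConst liftEquiv)
open Summit.QuantumFields.YangMills.BalabanUVNodes.N15.TwoGrid (chiCube cubeBlocks)
open Summit.QuantumFields.YangMills.BalabanUVNodes.N15.CurvedSpecies (gaugePair uN_exists_gauge_localCoefLetters_of_reg335Cube uN_localCoefLetters_of_gauge335)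
open Literature.MathematicalPhysics.QuantumFieldTheory.Balaban1983to89.T4EtaRateCoeffDefect (pull)
open Summit.QuantumFields.YangMills.BalabanUVNodes.N15.CovLandau (cgrad)

variable {d : ℕ}

section Green

variable {L : ℕ} [NeZero L]

set_option maxHeartbeats 800000 in

/-- ★★★★ **THE COVARIANT GRADIENT OF THE NAMED GREEN's FUNCTION AGAINST THE FLAT ONE, FROM (3.35) DATA**: for `(d, L, a₀, ι)` there are `δ, w₀, R₀, B, c_R` such that at every index
`(m, k)` with `L^m ≥ w₀`: a `U(m)` bond field `U` that is (3.35)-small IN THE TRIVIAL GAUGE on the two-collar boxes of the cubes NOT in `Far` and in Bałaban's per-cube class on the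
two-collar boxes of the far cubes (far regions inside `Z`, `d_Z` a distance minorant), with the letters `r_V ≥` the two (3.35) bounds and `r_V(1+|J⊕J|) + a₀|ι|(|ι|σ² + 2σ) ≤ R₀`,
satisfies, for every direction `μ`, `pull_μ∘mulVecLin (cgrad (cvT e U)·cGreen (cvT e U) a_K) − pull_μ∘mulVecLin (cgrad 𝟙·cGreen 𝟙 a_K) ≤
`B·[(1·(1 + r_Ve^{δ}c_R) + π)(r_V(1+|J⊕J|) + R_N(r_V) + (L^m)⁻¹ + e^{−(3δ∕128)d_Z(y)}) + r_Ve^{δ}]·e^{−(δ∕64)|y−y′|_T}` blockwise.  MODEL carriers; the SHAPE of [B9] (3.42) ∕ Cor. 3.8, NOT the printed statements.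
[cite: Balaban1985BackgroundPropagators, (3.42) p.397, (3.34)–(3.35) p.396, Cor. 3.8 p.410, (3.95)–(3.96) p.411, Thm 3.14 pp.426–427 (shape ∕ mechanism); Balaban1984PropagatorsII, (2.91)–(2.93) p.239, (2.133)–(2.136) p.247] -/
theorem hasMaj_cgradGreen_sub_of_reg335 (hL : Odd L ∧ 1 < L) (hL7 : 7 ≤ L) {a₀ : ℝ} (ha₀ : 0 < a₀) (ι : Type) [Fintype ι] [DecidableEq ι] :
    ∃ δ w₀ R₀ B cR : ℝ, 0 < δ ∧ 0 < R₀ ∧ 0 < B ∧ 0 ≤ cR ∧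
      ∀ (mv kk : ℕ), 1 ≤ kk → w₀ ≤ ((L ^ mv : ℕ) : ℝ) →
      ∀ {mm : Type} [Fintype mm] [DecidableEq mm] [Nonempty mm] (e : Matrix mm mm ℂ ≃L[ℝ] (ι → ℝ)), (∀ A B : Matrix mm mm ℂ, traceForm A B = e A ⬝ᵥ e B) →
      ∀ (Far : (Fin (d + 1) → ZMod (2 * L)) → Prop) [DecidablePred Far] (Z : Set (Tor (cvM d L mv kk hL))) (dZ : Tor (cvM d L mv kk hL) → ℝ),
        (∀ y z, z ∈ Z → dZ y ≤ (unitTorusGeo L kk (cvM d L mv kk hL)).dist y z) → (∀ y, 0 ≤ dZ y) → (∀ k, Far k → cvSk d L mv kk hL k ⊆ Z) →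
      ∀ (U : Fin (d + 1) → ScX d L mv kk hL → (Matrix mm mm ℂ)ˣ), (∀ μ x, (U μ x : Matrix mm mm ℂ) ∈ Matrix.unitaryGroup mm ℂ) →
      ∀ (ξ C : ℝ), 0 < ξ → 0 < C →
        (∀ k, Far k → Reg335Cube (scShift d L mv kk hL) U ((((L ^ kk : ℕ) : ℝ))⁻¹) {x : ScX d L mv kk hL | blockOf (L ^ kk) (cvM d L mv kk hL) x ∈ cubeBlocks (cvM d L mv kk hL) (coverCorner (cvM d L mv kk hL) (L ^ mv) L (2 * L ^ mv + 2) k) (6 * L ^ mv + 5)} ξ C) →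
        (∀ k, ¬Far k → ∃ A : Fin (d + 1) → ScX d L mv kk hL → Matrix mm mm ℂ, (∀ μ, ∀ z ∈ {x : ScX d L mv kk hL | blockOf (L ^ kk) (cvM d L mv kk hL) x ∈ cubeBlocks (cvM d L mv kk hL) (coverCorner (cvM d L mv kk hL) (L ^ mv) L (2 * L ^ mv + 2) k) (6 * L ^ mv + 5)}, gaugeTr (scShift d L mv kk hL) (fun _ => (1 : (Matrix mm mm ℂ)ˣ)) U μ z = fluct ((((L ^ kk : ℕ) : ℝ))⁻¹) A μ z) ∧
          (∀ μ, ∀ z ∈ {x : ScX d L mv kk hL | blockOf (L ^ kk) (cvM d L mv kk hL) x ∈ cubeBlocks (cvM d L mv kk hL) (coverCorner (cvM d L mv kk hL) (L ^ mv) L (2 * L ^ mv + 2) k) (6 * L ^ mv + 5)}, ‖A μ z‖ < C * ξ⁻¹) ∧ (∀ μ ν, ∀ z ∈ {x : ScX d L mv kk hL | blockOf (L ^ kk) (cvM d L mv kk hL) x ∈ cubeBlocks (cvM d L mv kk hL) (coverCorner (cvM d L mv kk hL) (L ^ mv) L (2 * L ^ mv + 2) k) (6 * L ^ mv + 5)},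 ‖((↑((((L ^ kk : ℕ) : ℝ))⁻¹) : ℂ)⁻¹) • covD (scShift d L mv kk hL) (fun _ _ => (1 : (Matrix mm mm ℂ)ˣ)) μ (A ν) z‖ < C * (ξ ^ 2)⁻¹)) →
      ∀ (rV : ℝ), 0 ≤ rV →
        Fintype.card ι * (@basisConst ι _ (Matrix mm mm ℂ) Matrix.frobeniusNormedAddCommGroup Matrix.frobeniusNormedSpace e * (2 * Real.sqrt (Fintype.card mm)) * (Real.sqrt (Fintype.card mm) * ((C / ξ) * Real.exp (((((L ^ kk : ℕ) : ℝ))⁻¹) * (C / ξ))))) ≤ rV →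
        Fintype.card ι * (Fintype.card (Fin (d + 1)) * (Fintype.card ι * (@basisConst ι _ (Matrix mm mm ℂ) Matrix.frobeniusNormedAddCommGroup Matrix.frobeniusNormedSpace e * (2 * Real.sqrt (Fintype.card mm)) * (Real.sqrt (Fintype.card mm) * ((C / ξ) * Real.exp (((((L ^ kk : ℕ) : ℝ))⁻¹) * (C / ξ))))) ^ 2 + @basisConst ι _ (Matrix mm mm ℂ) Matrix.frobeniusNormedAddCommGroup Matrix.frobeniusNormedSpace e * (2 * Real.sqrt (Fintype.card mm)) * (Real.sqrt (Fintype.card mm) * ((C / ξ ^ 2) * Real.exp (((((L ^ kk : ℕ) : ℝ))⁻¹) * (C / ξ)))))) ≤ rV →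
        rV * (1 + Fintype.card (Fin (d + 1) ⊕ Fin (d + 1))) + a₀ * (Fintype.card ι * (Fintype.card ι * ((1 + rV * ((((L ^ kk : ℕ) : ℝ))⁻¹)) ^ ((d + 1) * L ^ kk) - 1) ^ 2 + 2 * ((1 + rV * ((((L ^ kk : ℕ) : ℝ))⁻¹)) ^ ((d + 1) * L ^ kk) - 1))) ≤ R₀ →
      ∀ μ : Fin (d + 1), HasMaj (ScNorm d L mv kk hL ι) (ScNorm d L mv kk hL ι)
          (pull (fun p : ScX d L mv kk hL × ι => ((p.1, μ), p.2)) ∘ₗ Matrix.mulVecLin (cgrad (cvM d L mv kk hL) (L ^ kk) (cvT e (fun μ x => (U μ x : Matrix mm mm ℂ))) * cGreen (cvM d L mv kk hL) (L ^ kk) (cvT e (fun μ x => (U μ x : Matrix mm mm ℂ))) (aK a₀ (L : ℝ) kk * (((L ^ kk : ℕ) : ℝ)) ^ (d + 1))) -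
            pull (fun p : ScX d L mv kk hL × ι => ((p.1, μ), p.2)) ∘ₗ Matrix.mulVecLin (cgrad (cvM d L mv kk hL) (L ^ kk) (fun (_ : Fin (d + 1)) (_ : ScX d L mv kk hL) => (1 : Matrix ι ι ℝ)) * cGreen (cvM d L mv kk hL) (L ^ kk) (fun (_ : Fin (d + 1)) (_ : ScX d L mv kk hL) => (1 : Matrix ι ι ℝ)) (aK a₀ (L : ℝ) kk * (((L ^ kk : ℕ) : ℝ)) ^ (d + 1))))
          (fun y y' => B * ((1 * (1 + rV * Real.exp δ * cR) + π) * (rV * (1 + Fintype.card (Fin (d + 1) ⊕ Fin (d + 1))) + aK a₀ (L : ℝ) kk * (Fintype.card ι * (Fintype.card ι * ((1 + rV * ((((L ^ kk : ℕ) : ℝ))⁻¹)) ^ ((d + 1) * L ^ kk) - 1) ^ 2 + 2 * ((1 + rV * ((((L ^ kk : ℕ) : ℝ))⁻¹)) ^ ((d + 1) * L ^ kk) - 1))) + (((L ^ mv : ℕ) : ℝ))⁻¹ + Real.exp (-(3 * δ / 128 * dZ y))) + 1 * (rV * Real.exp δ)) *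
            Real.exp (-(δ / 64 * (unitTorusGeo L kk (cvM d L mv kk hL)).dist y y'))) := by
  obtain ⟨δ, w₀, R₀, θ₀, B, cR, hδ, hR₀, hθ₀, hB, hcR, H⟩ := uN_covD_scGlued_sub_spec (d := d) hL hL7 ha₀ ι
  obtain ⟨δq, w₀q, R₀q, θ₀q, Bq, hδq, hR₀q, hθ₀q, -, Hq⟩ := uN_scGlued_spec (d := d) hL hL7 ha₀ ι
  have hL1r : (1 : ℝ) < (L : ℝ) := by exact_mod_cast hL.2
  have hL3 : 3 ≤ L := by omega
  refine ⟨δ, max (max w₀ w₀q) 2, min R₀ R₀q, B, cR, hδ, lt_min hR₀ hR₀q, hB, hcR, fun mv kk hk hw₀ => ?_⟩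
  intro mm _ _ _ e he Far _ Z dZ hdZ hdZ0 hZ U hU ξ C hξ hC hfar hnear rV hrV hrA hrC hRle μ
  have hw₀' : w₀ ≤ ((L ^ mv : ℕ) : ℝ) := ((le_max_left _ _).trans (le_max_left _ _)).trans hw₀
  have hw₀q : w₀q ≤ ((L ^ mv : ℕ) : ℝ) := ((le_max_right _ _).trans (le_max_left _ _)).trans hw₀
  have hW2 : 2 ≤ L ^ mv := by have h := (le_max_right (max w₀ w₀q) 2).trans hw₀; exact_mod_cast h
  have hw : 0 < L ^ mv := by omega
  have hη : (0 : ℝ) < ((((L ^ kk : ℕ) : ℝ))⁻¹) := inv_pos.mpr (Nat.cast_pos.mpr (pow_pos (Nat.pos_of_ne_zero (NeZero.ne L)) kk))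
  have hnr : (0 : ℝ) < ((L ^ kk : ℕ) : ℝ) := by exact_mod_cast pow_pos (Nat.pos_of_ne_zero (NeZero.ne L)) kk
  have hM : ∀ ν, cvM d L mv kk hL ν = 2 * L * L ^ mv := MP_succ_eq L mv kk hL
  have hm₁ : 2 * L ^ mv ≤ coverMargin L mv := two_mul_le_coverMargin hL7 mv
  have hfitI : coverMargin L mv - 2 * L ^ mv + (6 * L ^ mv + 1) ≤ L * L ^ mv := coverMargin_inner_fit hL7 hW2
  have hS0 : L * L ^ mv ≤ 2 * L * L ^ mv := by rw [mul_assoc]; omega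
  have hS5 : 6 * L ^ mv + 5 ≤ 2 * L * L ^ mv := by
    have h7 : 7 * L ^ mv ≤ L * L ^ mv := Nat.mul_le_mul_right _ hL7
    have e2 : 2 * L * L ^ mv = 2 * (L * L ^ mv) := by ring
    rw [e2]; omega
  have hin : ∀ k (x : ScX d L mv kk hL), x ∈ {x : ScX d L mv kk hL | blockOf (L ^ kk) (cvM d L mv kk hL) x ∈ cubeBlocks (cvM d L mv kk hL) (coverCorner (cvM d L mv kk hL) (L ^ mv) L (2 * L ^ mv + 1) k) (6 * L ^ mv + 3)} → x ∈ {x : ScX d L mv kk hL | blockOf (L ^ kk) (cvM d L mv kk hL) x ∈ cubeBlocks (cvM d L mv kk hL) (coverCorner (cvM d L mv kk hL) (L ^ mv) L (2 * L ^ mv + 2) k) (6 * L ^ mv + 5)} := fun k x hx =>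
    mem_cubeBlocks_of_mem_inner (m₀ := 2 * L ^ mv + 2) (S₀ := 6 * L ^ mv + 5) hM (by omega) (by omega) hS5 hx
  -- King's window at the index
  have haK : 0 < aK a₀ (L : ℝ) kk := aK_pos ha₀ hL1r hk
  have haKle : aK a₀ (L : ℝ) kk ≤ a₀ := aK_le ha₀ hL1r hk
  have ha' : 0 < (aK a₀ (L : ℝ) kk * (((L ^ kk : ℕ) : ℝ)) ^ (d + 1)) := by positivity
  -- the letter of the cut row
  have hσ0 : 0 ≤ ((1 + rV * ((((L ^ kk : ℕ) : ℝ))⁻¹)) ^ ((d + 1) * L ^ kk) - 1) := by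
    have := one_le_pow₀ (M₀ := ℝ) (a := 1 + rV * ((((L ^ kk : ℕ) : ℝ))⁻¹)) (by nlinarith [hη.le]) (n := (d + 1) * L ^ kk); linarith
  have hLσ0 : 0 ≤ Fintype.card ι * (Fintype.card ι * ((1 + rV * ((((L ^ kk : ℕ) : ℝ))⁻¹)) ^ ((d + 1) * L ^ kk) - 1) ^ 2 + 2 * ((1 + rV * ((((L ^ kk : ℕ) : ℝ))⁻¹)) ^ ((d + 1) * L ^ kk) - 1)) := by positivity
  have hRN0 : 0 ≤ aK a₀ (L : ℝ) kk * (Fintype.card ι * (Fintype.card ι * ((1 + rV * ((((L ^ kk : ℕ) : ℝ))⁻¹)) ^ ((d + 1) * L ^ kk) - 1) ^ 2 + 2 * ((1 + rV * ((((L ^ kk : ℕ) : ℝ))⁻¹)) ^ ((d + 1) * L ^ kk) - 1))) := by positivity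
  have hRle' : rV * (1 + Fintype.card (Fin (d + 1) ⊕ Fin (d + 1))) + aK a₀ (L : ℝ) kk * (Fintype.card ι * (Fintype.card ι * ((1 + rV * ((((L ^ kk : ℕ) : ℝ))⁻¹)) ^ ((d + 1) * L ^ kk) - 1) ^ 2 + 2 * ((1 + rV * ((((L ^ kk : ℕ) : ℝ))⁻¹)) ^ ((d + 1) * L ^ kk) - 1))) ≤ R₀ :=
    by have := mul_le_mul_of_nonneg_right haKle hLσ0; linarith [min_le_left R₀ R₀q]
  have hRleq : rV * (1 + Fintype.card (Fin (d + 1) ⊕ Fin (d + 1))) + aK a₀ (L : ℝ) kk * (Fintype.card ι * (Fintype.card ι * ((1 + rV * ((((L ^ kk : ℕ) : ℝ))⁻¹)) ^ ((d + 1) * L ^ kk) - 1) ^ 2 + 2 * ((1 + rV * ((((L ^ kk : ℕ) : ℝ))⁻¹)) ^ ((d + 1) * L ^ kk) - 1))) ≤ R₀q :=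
    by have := mul_le_mul_of_nonneg_right haKle hLσ0; linarith [min_le_right R₀ R₀q]
  have habs : |(aK a₀ (L : ℝ) kk * (((L ^ kk : ℕ) : ℝ)) ^ (d + 1))| * ((((L ^ kk : ℕ) : ℝ)) ^ (d + 1))⁻¹ = aK a₀ (L : ℝ) kk := by
    rw [abs_of_pos ha', mul_assoc, mul_inv_cancel₀ (by positivity), mul_one]
  -- the per-cube gauges and their (3.35) letters from the class on the boxes (dag-n15-w2)
  have hU' : ∀ μ x, ((U μ x : Matrix mm mm ℂ))ᴴ * (U μ x : Matrix mm mm ℂ) = 1 := fun μ x => Matrix.mem_unitaryGroup_iff'.mp (hU μ x)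
  have h1u : ∀ (μ : Fin (d + 1)) (x : ScX d L mv kk hL), (((fun (_ : Fin (d + 1)) (_ : ScX d L mv kk hL) => (1 : (Matrix mm mm ℂ)ˣ)) μ x : (Matrix mm mm ℂ)ˣ) : Matrix mm mm ℂ) ∈ Matrix.unitaryGroup mm ℂ := fun μ x => by
    simp only [Units.val_one]; exact Submonoid.one_mem _
  have hone : ∀ z : ScX d L mv kk hL, ‖(((fun (_ : ScX d L mv kk hL) => (1 : (Matrix mm mm ℂ)ˣ)) z : (Matrix mm mm ℂ)ˣ) : Matrix mm mm ℂ)‖ ≤ 1 ∧ ‖((((fun (_ : ScX d L mv kk hL) => (1 : (Matrix mm mm ℂ)ˣ)) z)⁻¹ : (Matrix mm mm ℂ)ˣ) : Matrix mm mm ℂ)‖ ≤ 1 :=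
    fun z => by simp only [Units.val_one, inv_one]; exact ⟨norm_one.le, norm_one.le⟩
  -- FAR cubes: the class's gauge on the TWO-collar box extended by `1` (dag-n15-w2), its letters at the cut box and ONE STEP BEFORE it (n15-c∕275)
  choose wf hwfu hwfL using fun k (hk : Far k) => uN_exists_gauge_localCoefLetters_of_reg335Cube e (scShift d L mv kk hL) U he hη hU hξ hC.le (hfar k hk)
  have hwfC : ∀ k (hk : Far k), ∀ x, scChi d L mv kk hL k x ≠ 0 → ∀ i, ∑ j, |tCoefC ((((L ^ kk : ℕ) : ℝ))⁻¹) (gaugePair (scShift d L mv kk hL) fun μ y => coordMat e (ContinuousLinearMap.mulLeftRight ℝ (Matrix mm mm ℂ) (wf k hk y * (U μ y : Matrix mm mm ℂ) * (wf k hk (scShift d L mv kk hL μ y))ᴴ) (wf k hk y * (U μ y : Matrix mm mm ℂ) * (wf k hk (scShift d L mv kk hL μ y))ᴴ)ᴴ)) x i j| ≤ rV := fun k hk x hx i => by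
    obtain ⟨h0, h1, h2⟩ := scChi_ne_zero_nbhd hL hL7 mv kk k x hx
    exact (((hwfL k hk) x (hin k x h0) (fun μ => hin k _ (h1 μ)) (fun μ => hin k _ (h2 μ))).2 i).trans hrC
  have hwfA : ∀ k (hk : Far k), ∀ j' x, scChi d L mv kk hL k x ≠ 0 → ∀ i, ∑ j, |tCoefA ((((L ^ kk : ℕ) : ℝ))⁻¹) (gaugePair (scShift d L mv kk hL) fun μ y => coordMat e (ContinuousLinearMap.mulLeftRight ℝ (Matrix mm mm ℂ) (wf k hk y * (U μ y : Matrix mm mm ℂ) * (wf k hk (scShift d L mv kk hL μ y))ᴴ) (wf k hk y * (U μ y : Matrix mm mm ℂ) * (wf k hk (scShift d L mv kk hL μ y))ᴴ)ᴴ)) j' x i j| ≤ rV := fun k hk j' x hx i => by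
    obtain ⟨h0, h1, h2⟩ := scChi_ne_zero_nbhd hL hL7 mv kk k x hx
    exact (((hwfL k hk) x (hin k x h0) (fun μ => hin k _ (h1 μ)) (fun μ => hin k _ (h2 μ))).1 j' i).trans hrA
  have hwfAμ : ∀ k (hk : Far k), ∀ x, scChi d L mv kk hL k (scShift d L mv kk hL μ x) ≠ 0 → ∀ i, ∑ j, |tCoefA ((((L ^ kk : ℕ) : ℝ))⁻¹) (gaugePair (scShift d L mv kk hL) fun ν y => coordMat e (ContinuousLinearMap.mulLeftRight ℝ (Matrix mm mm ℂ) (wf k hk y * (U ν y : Matrix mm mm ℂ) * (wf k hk (scShift d L mv kk hL ν y))ᴴ) (wf k hk y * (U ν y : Matrix mm mm ℂ) * (wf k hk (scShift d L mv kk hL ν y))ᴴ)ᴴ)) (Sum.inl μ) x i j| ≤ rV := fun k hk x hx i => by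
    obtain ⟨h0, h1, h2⟩ := scShift_nbhd_mem_box2 hL hL7 mv kk hW2 k μ x hx
    exact (((hwfL k hk) x h0 h1 h2).1 (Sum.inl μ) i).trans hrA
  -- NEAR cubes: the letters in the trivial gauge (dag-n15-w2's letters of a (3.35) datum, `u = 1`, `w = 1`)
  have hnearL : ∀ k, ¬Far k → (∀ x, scChi d L mv kk hL k x ≠ 0 → ∀ i, ∑ j, |tCoefC ((((L ^ kk : ℕ) : ℝ))⁻¹) (gaugePair (scShift d L mv kk hL) fun μ y => coordMat e (ContinuousLinearMap.mulLeftRight ℝ (Matrix mm mm ℂ) ((fun _ => (1 : Matrix mm mm ℂ)) y * (U μ y : Matrix mm mm ℂ) * ((fun _ => (1 : Matrix mm mm ℂ)) (scShift d L mv kk hL μ y))ᴴ) ((fun _ => (1 : Matrix mm mm ℂ)) y * (U μ y : Matrix mm mm ℂ) * ((fun _ => (1 : Matrix mm mm ℂ)) (scShift d L mv kk hL μ y))ᴴ)ᴴ)) x i j| ≤ rV) ∧ (∀ j' x, scChi d L mv kk hL k x ≠ 0 → ∀ i, ∑ j, |tCoefA ((((L ^ kk : ℕ) : ℝ))⁻¹)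 (gaugePair (scShift d L mv kk hL) fun μ y => coordMat e (ContinuousLinearMap.mulLeftRight ℝ (Matrix mm mm ℂ) ((fun _ => (1 : Matrix mm mm ℂ)) y * (U μ y : Matrix mm mm ℂ) * ((fun _ => (1 : Matrix mm mm ℂ)) (scShift d L mv kk hL μ y))ᴴ) ((fun _ => (1 : Matrix mm mm ℂ)) y * (U μ y : Matrix mm mm ℂ) * ((fun _ => (1 : Matrix mm mm ℂ)) (scShift d L mv kk hL μ y))ᴴ)ᴴ)) j' x i j| ≤ rV) := fun k hk => by
    obtain ⟨A, hg, hA, hD⟩ := hnear k hk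
    have key := fun x (hx : scChi d L mv kk hL k x ≠ 0) =>
      uN_localCoefLetters_of_gauge335 e (scShift d L mv kk hL) U he hη hU hξ hC.le (fun z _ => hone z) hg hA hD (w := fun _ => (1 : Matrix mm mm ℂ))
        (fun _ => by rw [Matrix.conjTranspose_one, one_mul]) (fun z _ => Units.val_one.symm) (hin k x (scChi_ne_zero_nbhd hL hL7 mv kk k x hx).1)
        (fun μ => hin k _ ((scChi_ne_zero_nbhd hL hL7 mv kk k x hx).2.1 μ)) (fun μ => hin k _ ((scChi_ne_zero_nbhd hL hL7 mv kk k x hx).2.2 μ))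
    exact ⟨fun x hx i => ((key x hx).2 i).trans hrC, fun j' x hx i => ((key x hx).1 j' i).trans hrA⟩
  have hnearLμ : ∀ k, ¬Far k → ∀ x, scChi d L mv kk hL k (scShift d L mv kk hL μ x) ≠ 0 → ∀ i, ∑ j, |tCoefA ((((L ^ kk : ℕ) : ℝ))⁻¹) (gaugePair (scShift d L mv kk hL) fun ν y => coordMat e (ContinuousLinearMap.mulLeftRight ℝ (Matrix mm mm ℂ) ((fun _ => (1 : Matrix mm mm ℂ)) y * (U ν y : Matrix mm mm ℂ) * ((fun _ => (1 : Matrix mm mm ℂ)) (scShift d L mv kk hL ν y))ᴴ) ((fun _ => (1 : Matrix mm mm ℂ)) y * (U ν y : Matrix mm mm ℂ) * ((fun _ => (1 : Matrix mm mm ℂ)) (scShift d L mv kk hL ν y))ᴴ)ᴴ)) (Sum.inl μ) x i j| ≤ rV := fun k hk x hx i => by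
    obtain ⟨A, hg, hA, hD⟩ := hnear k hk
    obtain ⟨h0, h1, h2⟩ := scShift_nbhd_mem_box2 hL hL7 mv kk hW2 k μ x hx
    exact ((uN_localCoefLetters_of_gauge335 e (scShift d L mv kk hL) U he hη hU hξ hC.le (fun z _ => hone z) hg hA hD (w := fun _ => (1 : Matrix mm mm ℂ))
      (fun _ => by rw [Matrix.conjTranspose_one, one_mul]) (fun z _ => Units.val_one.symm) h0 h1 h2).1 (Sum.inl μ) i).trans hrA
  -- the FLAT field: letters of the trivial datum (`U = 1`, `u = 1`, `A = 0`)
  have hflatL : ∀ k : Fin (d + 1) → ZMod (2 * L), (∀ x, scChi d L mv kk hL k x ≠ 0 → ∀ i, ∑ j, |tCoefC ((((L ^ kk : ℕ) : ℝ))⁻¹) (gaugePair (scShift d L mv kk hL) fun μ y => coordMat e (ContinuousLinearMap.mulLeftRight ℝ (Matrix mm mm ℂ) ((fun _ => (1 : Matrix mm mm ℂ)) y * ((fun _ _ => (1 : (Matrix mm mm ℂ)ˣ)) μ y : Matrix mm mm ℂ) * ((fun _ => (1 : Matrix mm mm ℂ)) (scShift d L mv kk hL μ y))ᴴ) ((fun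 _ => (1 : Matrix mm mm ℂ)) y * ((fun _ _ => (1 : (Matrix mm mm ℂ)ˣ)) μ y : Matrix mm mm ℂ) * ((fun _ => (1 : Matrix mm mm ℂ)) (scShift d L mv kk hL μ y))ᴴ)ᴴ)) x i j| ≤ rV) ∧ (∀ j' x, scChi d L mv kk hL k x ≠ 0 → ∀ i, ∑ j, |tCoefA ((((L ^ kk : ℕ) : ℝ))⁻¹) (gaugePair (scShift d L mv kk hL) fun μ y => coordMat e (ContinuousLinearMap.mulLeftRight ℝ (Matrix mm mm ℂ) ((fun _ => (1 : Matrix mm mm ℂ)) y * ((fun _ _ => (1 : (Matrix mm mm ℂ)ˣ)) μ y : Matrix mm mm ℂ) * ((fun _ => (1 : Matrix mm mm ℂ)) (scShift d L mv kk hL μ y))ᴴ) ((fun _ => (1 : Matrix mm mm ℂ)) y * ((fun _ _ => (1 : (Matrix mm mm ℂ)ˣ)) μ y : Matrix mm mm ℂ) * ((fun _ => (1 : Matrix mm mm ℂ)) (scShift d L mv kk hL μ y))ᴴ)ᴴ)) j' x i j| ≤ rV) := fun k => by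
    have hg : ∀ μ, ∀ z ∈ {x : ScX d L mv kk hL | blockOf (L ^ kk) (cvM d L mv kk hL) x ∈ cubeBlocks (cvM d L mv kk hL) (coverCorner (cvM d L mv kk hL) (L ^ mv) L (2 * L ^ mv + 2) k) (6 * L ^ mv + 5)}, gaugeTr (scShift d L mv kk hL) (fun _ => (1 : (Matrix mm mm ℂ)ˣ)) (fun _ _ => (1 : (Matrix mm mm ℂ)ˣ)) μ z = fluct ((((L ^ kk : ℕ) : ℝ))⁻¹) (0 : Fin (d + 1) → ScX d L mv kk hL → Matrix mm mm ℂ) μ z :=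
      fun μ z _ => by rw [fluct_zero, gaugeTr_apply, inv_one, mul_one, mul_one]
    have hA : ∀ μ, ∀ z ∈ {x : ScX d L mv kk hL | blockOf (L ^ kk) (cvM d L mv kk hL) x ∈ cubeBlocks (cvM d L mv kk hL) (coverCorner (cvM d L mv kk hL) (L ^ mv) L (2 * L ^ mv + 2) k) (6 * L ^ mv + 5)}, ‖(0 : Fin (d + 1) → ScX d L mv kk hL → Matrix mm mm ℂ) μ z‖ < C * ξ⁻¹ := fun μ z _ => by
      rw [Pi.zero_apply, Pi.zero_apply, norm_zero]; exact mul_pos hC (inv_pos.2 hξ)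
    have hD : ∀ μ ν, ∀ z ∈ {x : ScX d L mv kk hL | blockOf (L ^ kk) (cvM d L mv kk hL) x ∈ cubeBlocks (cvM d L mv kk hL) (coverCorner (cvM d L mv kk hL) (L ^ mv) L (2 * L ^ mv + 2) k) (6 * L ^ mv + 5)}, ‖((↑((((L ^ kk : ℕ) : ℝ))⁻¹) : ℂ)⁻¹) • covD (scShift d L mv kk hL) (fun _ _ => (1 : (Matrix mm mm ℂ)ˣ)) μ ((0 : Fin (d + 1) → ScX d L mv kk hL → Matrix mm mm ℂ) ν) z‖ < C * (ξ ^ 2)⁻¹ :=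
      fun μ ν z _ => by rw [Pi.zero_apply, B9Eq335RegularityClasses.covD_zero, smul_zero, norm_zero]; exact mul_pos hC (inv_pos.2 (pow_pos hξ 2))
    have key := fun x (hx : scChi d L mv kk hL k x ≠ 0) =>
      uN_localCoefLetters_of_gauge335 e (scShift d L mv kk hL) (fun _ _ => (1 : (Matrix mm mm ℂ)ˣ)) he hη h1u hξ hC.le (fun z _ => hone z) hg hA hD (w := fun _ => (1 : Matrix mm mm ℂ))
        (fun _ => by rw [Matrix.conjTranspose_one, one_mul]) (fun z _ => Units.val_one.symm) (hin k x (scChi_ne_zero_nbhd hL hL7 mv kk k x hx).1)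
        (fun μ => hin k _ ((scChi_ne_zero_nbhd hL hL7 mv kk k x hx).2.1 μ)) (fun μ => hin k _ ((scChi_ne_zero_nbhd hL hL7 mv kk k x hx).2.2 μ))
    exact ⟨fun x hx i => ((key x hx).2 i).trans hrC, fun j' x hx i => ((key x hx).1 j' i).trans hrA⟩
  have hflatLμ : ∀ k : Fin (d + 1) → ZMod (2 * L), ∀ x, scChi d L mv kk hL k (scShift d L mv kk hL μ x) ≠ 0 → ∀ i, ∑ j, |tCoefA ((((L ^ kk : ℕ) : ℝ))⁻¹) (gaugePair (scShift d L mv kk hL) fun ν y => coordMat e (ContinuousLinearMap.mulLeftRight ℝ (Matrix mm mm ℂ) ((fun _ => (1 : Matrix mm mm ℂ)) y * ((fun _ _ => (1 : (Matrix mm mm ℂ)ˣ)) ν y : Matrix mm mm ℂ) * ((fun _ => (1 : Matrix mm mm ℂ)) (scShift d L mv kk hL ν y))ᴴ) ((fun _ => (1 : Matrix mm mm ℂ)) y * ((fun _ _ => (1 : (Matrix mm mm ℂ)ˣ)) ν y : Matrix mm mm ℂ) * ((fun _ => (1 : Matrix mm mm ℂ)) (scShift d L mv kk hL ν y))ᴴ)ᴴ))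 (Sum.inl μ) x i j| ≤ rV := fun k x hx i => by
    have hg : ∀ μ, ∀ z ∈ {x : ScX d L mv kk hL | blockOf (L ^ kk) (cvM d L mv kk hL) x ∈ cubeBlocks (cvM d L mv kk hL) (coverCorner (cvM d L mv kk hL) (L ^ mv) L (2 * L ^ mv + 2) k) (6 * L ^ mv + 5)}, gaugeTr (scShift d L mv kk hL) (fun _ => (1 : (Matrix mm mm ℂ)ˣ)) (fun _ _ => (1 : (Matrix mm mm ℂ)ˣ)) μ z = fluct ((((L ^ kk : ℕ) : ℝ))⁻¹) (0 : Fin (d + 1) → ScX d L mv kk hL → Matrix mm mm ℂ) μ z :=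
      fun μ z _ => by rw [fluct_zero, gaugeTr_apply, inv_one, mul_one, mul_one]
    have hA : ∀ μ, ∀ z ∈ {x : ScX d L mv kk hL | blockOf (L ^ kk) (cvM d L mv kk hL) x ∈ cubeBlocks (cvM d L mv kk hL) (coverCorner (cvM d L mv kk hL) (L ^ mv) L (2 * L ^ mv + 2) k) (6 * L ^ mv + 5)}, ‖(0 : Fin (d + 1) → ScX d L mv kk hL → Matrix mm mm ℂ) μ z‖ < C * ξ⁻¹ := fun μ z _ => by
      rw [Pi.zero_apply, Pi.zero_apply, norm_zero]; exact mul_pos hC (inv_pos.2 hξ)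
    have hD : ∀ μ ν, ∀ z ∈ {x : ScX d L mv kk hL | blockOf (L ^ kk) (cvM d L mv kk hL) x ∈ cubeBlocks (cvM d L mv kk hL) (coverCorner (cvM d L mv kk hL) (L ^ mv) L (2 * L ^ mv + 2) k) (6 * L ^ mv + 5)}, ‖((↑((((L ^ kk : ℕ) : ℝ))⁻¹) : ℂ)⁻¹) • covD (scShift d L mv kk hL) (fun _ _ => (1 : (Matrix mm mm ℂ)ˣ)) μ ((0 : Fin (d + 1) → ScX d L mv kk hL → Matrix mm mm ℂ) ν) z‖ < C * (ξ ^ 2)⁻¹ :=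
      fun μ ν z _ => by rw [Pi.zero_apply, B9Eq335RegularityClasses.covD_zero, smul_zero, norm_zero]; exact mul_pos hC (inv_pos.2 (pow_pos hξ 2))
    obtain ⟨h0, h1, h2⟩ := scShift_nbhd_mem_box2 hL hL7 mv kk hW2 k μ x hx
    exact ((uN_localCoefLetters_of_gauge335 e (scShift d L mv kk hL) (fun _ _ => (1 : (Matrix mm mm ℂ)ˣ)) he hη h1u hξ hC.le (fun z _ => hone z) hg hA hD (w := fun _ => (1 : Matrix mm mm ℂ))
      (fun _ => by rw [Matrix.conjTranspose_one, one_mul]) (fun z _ => Units.val_one.symm) h0 h1 h2).1 (Sum.inl μ) i).trans hrA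
  -- the first knit's gauges: the class's on the far cubes, `1` on the near ones
  have hwu : ∀ k x, ((fun k => if hk : Far k then wf k hk else fun _ => (1 : Matrix mm mm ℂ)) k x)ᴴ * (fun k => if hk : Far k then wf k hk else fun _ => (1 : Matrix mm mm ℂ)) k x = 1 := fun k x => by
    by_cases hk : Far k
    · simp only [dif_pos hk]; exact hwfu k hk x
    · simp only [dif_neg hk]; rw [Matrix.conjTranspose_one, one_mul]
  have h1w : ∀ (k : Fin (d + 1) → ZMod (2 * L)) (x : ScX d L mv kk hL), ((fun (_ : Fin (d + 1) → ZMod (2 * L)) (_ : ScX d L mv kk hL) => (1 : Matrix mm mm ℂ)) k x)ᴴ * (fun (_ : Fin (d + 1) → ZMod (2 * L)) (_ : ScX d L mv kk hL) => (1 : Matrix mm mm ℂ)) k x = 1 := fun k x => by rw [Matrix.conjTranspose_one, one_mul]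
  have hCw : ∀ k, ∀ x, scChi d L mv kk hL k x ≠ 0 → ∀ i, ∑ j, |tCoefC ((((L ^ kk : ℕ) : ℝ))⁻¹) (gaugePair (scShift d L mv kk hL) fun μ y => coordMat e (ContinuousLinearMap.mulLeftRight ℝ (Matrix mm mm ℂ) ((fun k => if hk : Far k then wf k hk else fun _ => (1 : Matrix mm mm ℂ)) k y * (U μ y : Matrix mm mm ℂ) * ((fun k => if hk : Far k then wf k hk else fun _ => (1 : Matrix mm mm ℂ)) k (scShift d L mv kk hL μ y))ᴴ) ((fun k => if hk : Far k then wf k hk else fun _ => (1 : Matrix mm mm ℂ)) k y * (U μ y : Matrix mm mm ℂ) * ((fun k => if hk : Far k then wf k hk else fun _ => (1 : Matrix mm mm ℂ)) k (scShift d L mv kk hL μ y))ᴴ)ᴴ)) x i j| ≤ rV := fun k => by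
    by_cases hk : Far k
    · simp only [dif_pos hk]; exact hwfC k hk
    · simp only [dif_neg hk]; exact (hnearL k hk).1
  have hAw : ∀ k, ∀ j' x, scChi d L mv kk hL k x ≠ 0 → ∀ i, ∑ j, |tCoefA ((((L ^ kk : ℕ) : ℝ))⁻¹) (gaugePair (scShift d L mv kk hL) fun μ y => coordMat e (ContinuousLinearMap.mulLeftRight ℝ (Matrix mm mm ℂ) ((fun k => if hk : Far k then wf k hk else fun _ => (1 : Matrix mm mm ℂ)) k y * (U μ y : Matrix mm mm ℂ) * ((fun k => if hk : Far k then wf k hk else fun _ => (1 : Matrix mm mm ℂ)) k (scShift d L mv kk hL μ y))ᴴ) ((fun k => if hk : Far k then wf k hk else fun _ => (1 : Matrix mm mm ℂ)) k y * (U μ y : Matrix mm mm ℂ) * ((fun k => if hk : Far k then wf k hk else fun _ => (1 : Matrix mm mm ℂ)) k (scShift d L mv kk hL μ y))ᴴ)ᴴ)) j' x i j| ≤ rV := fun k => by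
    by_cases hk : Far k
    · simp only [dif_pos hk]; exact hwfA k hk
    · simp only [dif_neg hk]; exact (hnearL k hk).2
  have hAwμ : ∀ k, ∀ x, scChi d L mv kk hL k (scShift d L mv kk hL μ x) ≠ 0 → ∀ i, ∑ j, |tCoefA ((((L ^ kk : ℕ) : ℝ))⁻¹) (gaugePair (scShift d L mv kk hL) fun ν y => coordMat e (ContinuousLinearMap.mulLeftRight ℝ (Matrix mm mm ℂ) ((fun k => if hk : Far k then wf k hk else fun _ => (1 : Matrix mm mm ℂ)) k y * (U ν y : Matrix mm mm ℂ) * ((fun k => if hk : Far k then wf k hk else fun _ => (1 : Matrix mm mm ℂ)) k (scShift d L mv kk hL ν y))ᴴ) ((fun k => if hk : Far k then wf k hk else fun _ => (1 : Matrix mm mm ℂ)) k y * (U ν y : Matrix mm mm ℂ) * ((fun k => if hk : Far k then wf k hk else fun _ => (1 : Matrix mm mm ℂ)) k (scShift d L mv kk hL ν y))ᴴ)ᴴ)) (Sum.inl μ) x i j| ≤ rV := fun k => by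
    by_cases hk : Far k
    · simp only [dif_pos hk]; exact hwfAμ k hk
    · simp only [dif_neg hk]; exact hnearLμ k hk
  have key := H mv kk hk hw₀' e he Far Z dZ hdZ hdZ0 hZ (fun k => if hk : Far k then wf k hk else fun _ => 1) (fun (_ : Fin (d + 1) → ZMod (2 * L)) (_ : ScX d L mv kk hL) => (1 : Matrix mm mm ℂ)) hwu h1w (fun k hk => by simp only [dif_neg hk])
    (fun μ x => (U μ x : Matrix mm mm ℂ)) (fun (_ : Fin (d + 1)) (_ : ScX d L mv kk hL) => ((1 : (Matrix mm mm ℂ)ˣ) : Matrix mm mm ℂ)) (scP d L mv kk hL (aK a₀ (L : ℝ) kk * (((L ^ kk : ℕ) : ℝ)) ^ (d + 1)) ι e (fun μ x => (U μ x : Matrix mm mm ℂ))) (scP d L mv kk hL (aK a₀ (L : ℝ) kk * (((L ^ kk : ℕ) : ℝ)) ^ (d + 1)) ι e (fun (_ : Fin (d + 1)) (_ : ScX d L mv kk hL) => ((1 : (Matrix mm mm ℂ)ˣ) : Matrix mm mm ℂ)))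
    (scNV d L mv kk hL (aK a₀ (L : ℝ) kk * (((L ^ kk : ℕ) : ℝ)) ^ (d + 1)) ι e (fun k => if hk : Far k then wf k hk else fun _ => 1) (fun μ x => (U μ x : Matrix mm mm ℂ))) (scNV d L mv kk hL (aK a₀ (L : ℝ) kk * (((L ^ kk : ℕ) : ℝ)) ^ (d + 1)) ι e (fun (_ : Fin (d + 1) → ZMod (2 * L)) (_ : ScX d L mv kk hL) => (1 : Matrix mm mm ℂ)) (fun (_ : Fin (d + 1)) (_ : ScX d L mv kk hL) => ((1 : (Matrix mm mm ℂ)ˣ) : Matrix mm mm ℂ))) rV (aK a₀ (L : ℝ) kk * (Fintype.card ι * (Fintype.card ι * ((1 + rV * ((((L ^ kk : ℕ) : ℝ))⁻¹)) ^ ((d + 1) * L ^ kk) - 1) ^ 2 + 2 * ((1 + rV * ((((L ^ kk : ℕ) : ℝ))⁻¹)) ^ ((d + 1) * L ^ kk) - 1)))) 0 hrV hRN0 le_rfl hRle' hθ₀.le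
    (fun k => scP_conj ι e (aK a₀ (L : ℝ) kk * (((L ^ kk : ℕ) : ℝ)) ^ (d + 1)) (fun k => if hk : Far k then wf k hk else fun _ => 1) (fun μ x => (U μ x : Matrix mm mm ℂ)) k) (fun k => hCw k) (fun k => hAw k)
    (fun k => (hasMaj_scNV_cut_of_rows ι e he (aK a₀ (L : ℝ) kk * (((L ^ kk : ℕ) : ℝ)) ^ (d + 1)) hwu (fun μ x => (U μ x : Matrix mm mm ℂ)) hrV k (fun μ x hx i => hAw k (Sum.inl μ) x hx i) δ).mono fun y y' =>
      mul_le_mul_of_nonneg_right (le_of_eq (by rw [habs])) (Real.exp_nonneg _))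
    (fun k => by
      rw [one_sub_scPsi_comp_scNV_comp_scChi ι e he hM hm₁ hfitI hS0 (aK a₀ (L : ℝ) kk * (((L ^ kk : ℕ) : ℝ)) ^ (d + 1)) hwu (fun μ x => (U μ x : Matrix mm mm ℂ)) k]
      exact (hasMaj_zero _ _).mono fun y y' => by positivity)
    (fun k => scP_conj ι e (aK a₀ (L : ℝ) kk * (((L ^ kk : ℕ) : ℝ)) ^ (d + 1)) (fun (_ : Fin (d + 1) → ZMod (2 * L)) (_ : ScX d L mv kk hL) => (1 : Matrix mm mm ℂ)) (fun (_ : Fin (d + 1)) (_ : ScX d L mv kk hL) => ((1 : (Matrix mm mm ℂ)ˣ) : Matrix mm mm ℂ)) k) (fun k => (hflatL k).1) (fun k => (hflatL k).2)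
    (fun k => (hasMaj_scNV_cut_of_rows ι e he (aK a₀ (L : ℝ) kk * (((L ^ kk : ℕ) : ℝ)) ^ (d + 1)) h1w (fun (_ : Fin (d + 1)) (_ : ScX d L mv kk hL) => ((1 : (Matrix mm mm ℂ)ˣ) : Matrix mm mm ℂ)) hrV k (fun μ x hx i => (hflatL k).2 (Sum.inl μ) x hx i) δ).mono fun y y' =>
      mul_le_mul_of_nonneg_right (le_of_eq (by rw [habs])) (Real.exp_nonneg _))
    (fun k => by
      rw [one_sub_scPsi_comp_scNV_comp_scChi ι e he hM hm₁ hfitI hS0 (aK a₀ (L : ℝ) kk * (((L ^ kk : ℕ) : ℝ)) ^ (d + 1)) h1w (fun (_ : Fin (d + 1)) (_ : ScX d L mv kk hL) => ((1 : (Matrix mm mm ℂ)ˣ) : Matrix mm mm ℂ)) k]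
      exact (hasMaj_zero _ _).mono fun y y' => by positivity)
    μ rV hrV hAwμ (fun k => hflatLμ k)
  -- both knits invert their operators (n15-c∕262), hence are the named Green's functions (n15-c∕266)
  have h1U : ∀ (μ : Fin (d + 1)) (x : ScX d L mv kk hL), ((fun (_ : Fin (d + 1)) (_ : ScX d L mv kk hL) => ((1 : (Matrix mm mm ℂ)ˣ) : Matrix mm mm ℂ)) μ x)ᴴ * (fun (_ : Fin (d + 1)) (_ : ScX d L mv kk hL) => ((1 : (Matrix mm mm ℂ)ˣ) : Matrix mm mm ℂ)) μ x = 1 := fun μ x => by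
    simp only [Units.val_one, Matrix.conjTranspose_one, one_mul]
  obtain ⟨-, hleft₁, -⟩ := Hq mv kk hk hw₀q e he (fun k => if hk : Far k then wf k hk else fun _ => 1) hwu (fun μ x => (U μ x : Matrix mm mm ℂ)) (scP d L mv kk hL (aK a₀ (L : ℝ) kk * (((L ^ kk : ℕ) : ℝ)) ^ (d + 1)) ι e (fun μ x => (U μ x : Matrix mm mm ℂ)))
    (scNV d L mv kk hL (aK a₀ (L : ℝ) kk * (((L ^ kk : ℕ) : ℝ)) ^ (d + 1)) ι e (fun k => if hk : Far k then wf k hk else fun _ => 1) (fun μ x => (U μ x : Matrix mm mm ℂ))) rV (aK a₀ (L : ℝ) kk * (Fintype.card ι * (Fintype.card ι * ((1 + rV * ((((L ^ kk : ℕ) : ℝ))⁻¹)) ^ ((d + 1) * L ^ kk) - 1) ^ 2 + 2 * ((1 + rV * ((((L ^ kk : ℕ) : ℝ))⁻¹)) ^ ((d + 1) * L ^ kk) - 1)))) 0 hrV hRN0 le_rfl hRleq hθ₀q.le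
    (fun k => scP_conj ι e (aK a₀ (L : ℝ) kk * (((L ^ kk : ℕ) : ℝ)) ^ (d + 1)) (fun k => if hk : Far k then wf k hk else fun _ => 1) (fun μ x => (U μ x : Matrix mm mm ℂ)) k) (fun k => hCw k) (fun k => hAw k)
    (fun k => (hasMaj_scNV_cut_of_rows ι e he (aK a₀ (L : ℝ) kk * (((L ^ kk : ℕ) : ℝ)) ^ (d + 1)) hwu (fun μ x => (U μ x : Matrix mm mm ℂ)) hrV k (fun μ x hx i => hAw k (Sum.inl μ) x hx i) δq).mono fun y y' =>
      mul_le_mul_of_nonneg_right (le_of_eq (by rw [habs])) (Real.exp_nonneg _))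
    (fun k => by
      rw [one_sub_scPsi_comp_scNV_comp_scChi ι e he hM hm₁ hfitI hS0 (aK a₀ (L : ℝ) kk * (((L ^ kk : ℕ) : ℝ)) ^ (d + 1)) hwu (fun μ x => (U μ x : Matrix mm mm ℂ)) k]
      exact (hasMaj_zero _ _).mono fun y y' => by positivity)
  obtain ⟨-, hleft₂, -⟩ := Hq mv kk hk hw₀q e he (fun (_ : Fin (d + 1) → ZMod (2 * L)) (_ : ScX d L mv kk hL) => (1 : Matrix mm mm ℂ)) h1w (fun (_ : Fin (d + 1)) (_ : ScX d L mv kk hL) => ((1 : (Matrix mm mm ℂ)ˣ) : Matrix mm mm ℂ)) (scP d L mv kk hL (aK a₀ (L : ℝ) kk * (((L ^ kk : ℕ) : ℝ)) ^ (d + 1)) ι e (fun (_ : Fin (d + 1)) (_ : ScX d L mv kk hL) => ((1 : (Matrix mm mm ℂ)ˣ) : Matrix mm mm ℂ))) (scNV d L mv kk hL (aK a₀ (L : ℝ) kk * (((L ^ kk : ℕ) : ℝ)) ^ (d + 1)) ι e (fun (_ : Fin (d + 1) → ZMod (2 * L)) (_ : ScX d L mv kk hL) => (1 : Matrix mm mm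 ℂ)) (fun (_ : Fin (d + 1)) (_ : ScX d L mv kk hL) => ((1 : (Matrix mm mm ℂ)ˣ) : Matrix mm mm ℂ))) rV (aK a₀ (L : ℝ) kk * (Fintype.card ι * (Fintype.card ι * ((1 + rV * ((((L ^ kk : ℕ) : ℝ))⁻¹)) ^ ((d + 1) * L ^ kk) - 1) ^ 2 + 2 * ((1 + rV * ((((L ^ kk : ℕ) : ℝ))⁻¹)) ^ ((d + 1) * L ^ kk) - 1)))) 0 hrV hRN0 le_rfl hRleq hθ₀q.le
    (fun k => scP_conj ι e (aK a₀ (L : ℝ) kk * (((L ^ kk : ℕ) : ℝ)) ^ (d + 1)) (fun (_ : Fin (d + 1) → ZMod (2 * L)) (_ : ScX d L mv kk hL) => (1 : Matrix mm mm ℂ)) (fun (_ : Fin (d + 1)) (_ : ScX d L mv kk hL) => ((1 : (Matrix mm mm ℂ)ˣ) : Matrix mm mm ℂ)) k) (fun k => (hflatL k).1) (fun k => (hflatL k).2)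
    (fun k => (hasMaj_scNV_cut_of_rows ι e he (aK a₀ (L : ℝ) kk * (((L ^ kk : ℕ) : ℝ)) ^ (d + 1)) h1w (fun (_ : Fin (d + 1)) (_ : ScX d L mv kk hL) => ((1 : (Matrix mm mm ℂ)ˣ) : Matrix mm mm ℂ)) hrV k (fun μ x hx i => (hflatL k).2 (Sum.inl μ) x hx i) δq).mono fun y y' =>
      mul_le_mul_of_nonneg_right (le_of_eq (by rw [habs])) (Real.exp_nonneg _))
    (fun k => by
      rw [one_sub_scPsi_comp_scNV_comp_scChi ι e he hM hm₁ hfitI hS0 (aK a₀ (L : ℝ) kk * (((L ^ kk : ℕ) : ℝ)) ^ (d + 1)) h1w (fun (_ : Fin (d + 1)) (_ : ScX d L mv kk hL) => ((1 : (Matrix mm mm ℂ)ˣ) : Matrix mm mm ℂ)) k]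
      exact (hasMaj_zero _ _).mono fun y y' => by positivity)
  have hleft₁' : scGlued d L mv kk hL (aK a₀ (L : ℝ) kk * (((L ^ kk : ℕ) : ℝ)) ^ (d + 1)) ((((L ^ kk : ℕ) : ℝ))⁻¹) ι e (fun k => if hk : Far k then wf k hk else fun _ => 1) (fun μ x => (U μ x : Matrix mm mm ℂ)) (scP d L mv kk hL (aK a₀ (L : ℝ) kk * (((L ^ kk : ℕ) : ℝ)) ^ (d + 1)) ι e (fun μ x => (U μ x : Matrix mm mm ℂ))) (scNV d L mv kk hL (aK a₀ (L : ℝ) kk * (((L ^ kk : ℕ) : ℝ)) ^ (d + 1)) ι e (fun k => if hk : Far k then wf k hk else fun _ => 1) (fun μ x => (U μ x : Matrix mm mm ℂ))) ∘ₗ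
      Matrix.mulVecLin (claplA (cvM d L mv kk hL) (L ^ kk) (cvT e (fun μ x => (U μ x : Matrix mm mm ℂ))) (aK a₀ (L : ℝ) kk * (((L ^ kk : ℕ) : ℝ)) ^ (d + 1))) = LinearMap.id := by
    rw [← covLapM_add_scP_eq_mulVecLin_claplA ι e he (aK a₀ (L : ℝ) kk * (((L ^ kk : ℕ) : ℝ)) ^ (d + 1)) (fun μ x => (U μ x : Matrix mm mm ℂ)) hU']; exact hleft₁
  have hleft₂' : scGlued d L mv kk hL (aK a₀ (L : ℝ) kk * (((L ^ kk : ℕ) : ℝ)) ^ (d + 1)) ((((L ^ kk : ℕ) : ℝ))⁻¹) ι e (fun (_ : Fin (d + 1) → ZMod (2 * L)) (_ : ScX d L mv kk hL) => (1 : Matrix mm mm ℂ)) (fun (_ : Fin (d + 1)) (_ : ScX d L mv kk hL) => ((1 : (Matrix mm mm ℂ)ˣ) : Matrix mm mm ℂ)) (scP d L mv kk hL (aK a₀ (L : ℝ) kk * (((L ^ kk : ℕ) : ℝ)) ^ (d + 1)) ι e (fun (_ : Fin (d + 1)) (_ : ScX d L mv kk hL) => ((1 : (Matrix mm mm ℂ)ˣ)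 : Matrix mm mm ℂ))) (scNV d L mv kk hL (aK a₀ (L : ℝ) kk * (((L ^ kk : ℕ) : ℝ)) ^ (d + 1)) ι e (fun (_ : Fin (d + 1) → ZMod (2 * L)) (_ : ScX d L mv kk hL) => (1 : Matrix mm mm ℂ)) (fun (_ : Fin (d + 1)) (_ : ScX d L mv kk hL) => ((1 : (Matrix mm mm ℂ)ˣ) : Matrix mm mm ℂ))) ∘ₗ Matrix.mulVecLin (claplA (cvM d L mv kk hL) (L ^ kk) (cvT e (fun (_ : Fin (d + 1)) (_ : ScX d L mv kk hL) => ((1 : (Matrix mm mm ℂ)ˣ) : Matrix mm mm ℂ))) (aK a₀ (L : ℝ) kk * (((L ^ kk : ℕ) : ℝ)) ^ (d + 1))) = LinearMap.id := by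
    rw [← covLapM_add_scP_eq_mulVecLin_claplA ι e he (aK a₀ (L : ℝ) kk * (((L ^ kk : ℕ) : ℝ)) ^ (d + 1)) (fun (_ : Fin (d + 1)) (_ : ScX d L mv kk hL) => ((1 : (Matrix mm mm ℂ)ˣ) : Matrix mm mm ℂ)) h1U]; exact hleft₂
  rw [eq_mulVecLin_cGreen_of_comp_eq_id (isUnit_cvT ι e he (fun μ x => (U μ x : Matrix mm mm ℂ)) hU') ha' hleft₁', eq_mulVecLin_cGreen_of_comp_eq_id (isUnit_cvT ι e he (fun (_ : Fin (d + 1)) (_ : ScX d L mv kk hL) => ((1 : (Matrix mm mm ℂ)ˣ) : Matrix mm mm ℂ)) h1U) ha' hleft₂'] at key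
  -- n15-c∕270's dictionary on the GOAL side (the knits' covariant derivatives are `covD (cvT e ·) (· + e_μ)` definitionally; the flat transporter datum is `1` by `cvT_one`)
  have hflat : MatrixSpecies.covD ((((L ^ kk : ℕ) : ℝ))⁻¹) ((fun (_ : Fin (d + 1)) (_ : ScX d L mv kk hL) => (1 : Matrix ι ι ℝ)) μ) (fun x => x + unitVec (fine (L ^ kk) (cvM d L mv kk hL)) μ) ∘ₗ Matrix.mulVecLin (cGreen (cvM d L mv kk hL) (L ^ kk) (fun (_ : Fin (d + 1)) (_ : ScX d L mv kk hL) => (1 : Matrix ι ι ℝ)) (aK a₀ (L : ℝ) kk * (((L ^ kk : ℕ) : ℝ)) ^ (d + 1))) =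
      MatrixSpecies.covD ((((L ^ kk : ℕ) : ℝ))⁻¹) (cvT e (fun (_ : Fin (d + 1)) (_ : ScX d L mv kk hL) => ((1 : (Matrix mm mm ℂ)ˣ) : Matrix mm mm ℂ)) μ) (fun x => x + unitVec (fine (L ^ kk) (cvM d L mv kk hL)) μ) ∘ₗ
        Matrix.mulVecLin (cGreen (cvM d L mv kk hL) (L ^ kk) (cvT e (fun (_ : Fin (d + 1)) (_ : ScX d L mv kk hL) => ((1 : (Matrix mm mm ℂ)ˣ) : Matrix mm mm ℂ))) (aK a₀ (L : ℝ) kk * (((L ^ kk : ℕ) : ℝ)) ^ (d + 1))) := by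
    rw [show (fun (_ : Fin (d + 1)) (_ : ScX d L mv kk hL) => ((1 : (Matrix mm mm ℂ)ˣ) : Matrix mm mm ℂ)) = fun _ _ => (1 : Matrix mm mm ℂ) from funext fun _ => funext fun _ => Units.val_one, cvT_one e]
  rw [← covD_comp_mulVecLin_eq_pull (cvM d L mv kk hL) (L ^ kk) (cvT e (fun μ x => (U μ x : Matrix mm mm ℂ))) μ,
    ← covD_comp_mulVecLin_eq_pull (cvM d L mv kk hL) (L ^ kk) (fun (_ : Fin (d + 1)) (_ : ScX d L mv kk hL) => (1 : Matrix ι ι ℝ)) μ, hflat]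
  exact key.mono fun y y' => le_of_eq (by ring)

end Green

end Summit.QuantumFields.YangMills.BalabanUVNodes.N15.Gluing

end
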